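import Mathlib.Analysis.MeanInequalities
import Mathlib.Analysis.PSeries
import Literature.Analysis.FunctionSpaces.TorusInverseLaplacianL2
import Literature.Analysis.FunctionSpaces.TorusFourierSynthesis
import HarnessLib

/-!
# A sup-norm bound for the inverse Laplacian on the flat torus in dimension `≤ 3`

Analysis/FunctionSpaces support file (everything proved). For the accepted mean-zero inverse
Laplacian `Torus.invLaplacian` (`TorusInverseLaplacian`; Cheskidov–Luo 2022, §7.2) on `T^d` with
`#d ≤ 3` we prove the elementary bound

  `|Δ⁻¹h (x)| ≤ C_d ‖h‖_{L²(T^d)} ≤ C_d sup |h|`      (`h ∈ C^∞(T^d)` real),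

`C_d = (∑_{k ≠ 0} (4π²|k|²)⁻²)^{1/2}`, by Fourier inversion for the smooth function `Δ⁻¹h`
(`Torus.IsSmooth.fourierSynth_mFourierCoeff`, Grafakos 2014, Prop. 3.2.5), the coefficient formula
`𝓕(Δ⁻¹h)(k) = -(4π²|k|²)⁻¹ 𝓕h(k)` (`Torus.mFourierCoeff_ofReal_invLaplacian`), Cauchy–Schwarz in
`ℓ²(ℤ^d)` and Parseval; the lattice sum `∑_{k ≠ 0} |k|⁻⁴` converges exactly when `d ≤ 3`. This is
the (trivial, `H² ⊂ L^∞`) sup-norm input of the heat-kernel proof of the Hölder boundedness of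
the second Riesz transforms `∂ᵢ∂ⱼΔ⁻¹` on `T³` (`FluidPDE/OnsagerBDSVPotentialTheoryProofs`,
Buckmaster–De Lellis–Székelyhidi–Vicol 2019, App. C, Prop. C.1).

## Main statements (all proved)

* `Torus.summable_one_add_sq_rpow_neg`, `Torus.summable_one_add_freqNormSq_rpow_neg`: the lattice
  `p`-series `∑_{k ∈ ℤ^d} (1 + |k|²)^{-s} < ∞` for `2s > #d` (product trick of `TorusFourierSeries`);
* `Torus.summable_sq_norm_invLaplacianMultiplier`: `∑_k |m(k)|² < ∞` for `#d ≤ 3`;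
* `Torus.norm_invLaplacian_le_mul_sqrt_integral_sq`, `Torus.norm_invLaplacian_le_of_forall_abs_le`:
  the displayed bounds.

## References

* L. Grafakos, *Classical Fourier Analysis*, 3rd ed., GTM 249 (2014), Prop. 3.2.5 (Fourier
  inversion for absolutely summable coefficients), Prop. 3.2.7 (Parseval). [`Grafakos2014`]
* A. Cheskidov, X. Luo, *Sharp nonuniqueness for the Navier–Stokes equations*, Invent. Math. 229
  (2022), §7.2 (`Δ⁻¹` on `C^∞(𝕋^d)`). [`CheskidovLuo2022`]
-/

noncomputable section

open MeasureTheory Set Filter Topology UnitAddTorus Function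
open scoped ENNReal NNReal ContDiff

namespace Literature.Analysis.FunctionSpaces

namespace Torus

variable {d : Type*} [Fintype d]

/-! ## Lattice `p`-series -/

section Lattice

omit [Fintype d] in
/-- `∑_{n ∈ ℤ} (1 + n²)^{-r} < ∞` for `r > 1/2` (comparison with `∑ |n|^{-2r}`,
`Real.summable_abs_int_rpow`, off `n = 0`). [folklore] -/
theorem summable_one_add_sq_rpow_neg {r : ℝ} (hr : 1 / 2 < r) :
    Summable fun n : ℤ => (1 + (n : ℝ) ^ 2) ^ (-r) := by
  have h1 : Summable fun n : ℤ => |(n : ℝ)| ^ (-(2 * r)) := Real.summable_abs_int_rpow (by linarith)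
  have h0 : Summable (fun n : ℤ => if n = 0 then (1 : ℝ) else 0) :=
    summable_of_ne_finset_zero (s := {0}) fun j hj => by
      rw [Finset.mem_singleton] at hj
      rw [if_neg hj]
  refine Summable.of_nonneg_of_le (fun n => by positivity) (fun n => ?_) (h1.add h0)
  by_cases hn : n = 0
  · subst hn
    simp only [Int.cast_zero, if_true, abs_zero]
    rw [Real.zero_rpow (by linarith : -(2 * r) ≠ 0), zero_add]
    have : (1 + (0 : ℝ) ^ 2) ^ (-r) = 1 := by norm_num
    rw [this]
  · rw [if_neg hn, add_zero]
    have hpos : 0 < |(n : ℝ)| := abs_pos.2 (Int.cast_ne_zero.2 hn)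
    have hsq : 0 < (n : ℝ) ^ 2 := by positivity
    calc (1 + (n : ℝ) ^ 2) ^ (-r) ≤ ((n : ℝ) ^ 2) ^ (-r) :=
          Real.rpow_le_rpow_of_nonpos hsq (by linarith) (by linarith)
      _ = |(n : ℝ)| ^ (-(2 * r)) := by
          rw [← sq_abs, ← Real.rpow_natCast, ← Real.rpow_mul hpos.le]
          norm_num

/-- **Lattice `p`-series**: `∑_{k ∈ ℤ^d} (1 + |k|²)^{-s} < ∞` whenever `2s > #d` (`d` nonempty):
`(1 + |k|²)^{-s} ≤ ∏ᵢ (1 + kᵢ²)^{-s/#d}` and the product trick `Torus.summable_pi_prod_of_summable`.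
[folklore] -/
theorem summable_one_add_freqNormSq_rpow_neg [Nonempty d] {s : ℝ}
    (hs : (Fintype.card d : ℝ) < 2 * s) :
    Summable fun k : d → ℤ => (1 + freqNormSq k) ^ (-s) := by
  set c : ℕ := Fintype.card d with hc
  have hc0 : (0 : ℝ) < c := by exact_mod_cast Fintype.card_pos
  set r : ℝ := s / c with hr
  have hr2 : 1 / 2 < r := by
    rw [hr, lt_div_iff₀ hc0]
    linarith
  have hrc : r * c = s := by rw [hr]; field_simp
  have hr0 : 0 ≤ r := by linarith
  set a : ℤ → ℝ := fun n => (1 + (n : ℝ) ^ 2) ^ (-r) with ha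
  have ha0 : ∀ n, 0 ≤ a n := fun n => Real.rpow_nonneg (by positivity) _
  have hb0 : ∀ k : d → ℤ, 0 ≤ 1 + freqNormSq k := fun k => by linarith [freqNormSq_nonneg k]
  refine Summable.of_nonneg_of_le (fun k => Real.rpow_nonneg (hb0 k) _) (fun k => ?_)
    (summable_pi_prod_of_summable ha0 (summable_one_add_sq_rpow_neg hr2))
  have h1 : ∀ i, (1 + freqNormSq k) ^ (-r) ≤ a (k i) := fun i => by
    have hle : 1 + ((k i : ℝ)) ^ 2 ≤ 1 + freqNormSq k := by
      have : ((k i : ℝ)) ^ 2 ≤ freqNormSq k :=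
        Finset.single_le_sum (f := fun j => ((k j : ℝ)) ^ 2) (fun j _ => sq_nonneg _) (Finset.mem_univ i)
      linarith
    exact Real.rpow_le_rpow_of_nonpos (by positivity) hle (by linarith)
  calc (1 + freqNormSq k) ^ (-s) = ((1 + freqNormSq k) ^ (-r)) ^ (c : ℝ) := by
        rw [← Real.rpow_mul (by linarith [freqNormSq_nonneg k])]
        congr 1
        rw [← hrc]
        ring
    _ = ∏ _i : d, (1 + freqNormSq k) ^ (-r) := by
        rw [Finset.prod_const, Finset.card_univ, ← hc, Real.rpow_natCast]
    _ ≤ ∏ i, a (k i) := Finset.prod_le_prod (fun i _ => Real.rpow_nonneg (hb0 k) _) fun i _ => h1 i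

/-- `∑_k |m(k)|² < ∞` on `ℤ^d`, `#d ≤ 3`, for the symbol `m(k) = -(4π²|k|²)⁻¹` (`k ≠ 0`) of `Δ⁻¹`
(`|m(k)|² ≤ 4(4π²)⁻² (1 + |k|²)⁻²` and `4 > #d`). [folklore] -/
theorem summable_sq_norm_invLaplacianMultiplier [Nonempty d] [DecidableEq d]
    (hd : Fintype.card d ≤ 3) :
    Summable fun k : d → ℤ => ‖invLaplacianMultiplier k‖ ^ 2 := by
  have hs : (Fintype.card d : ℝ) < 2 * 2 := by
    have : (Fintype.card d : ℝ) ≤ 3 := by exact_mod_cast hd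
    linarith
  have hsum := (summable_one_add_freqNormSq_rpow_neg hs).mul_left (4 * ((4 * Real.pi ^ 2)⁻¹) ^ 2)
  have hb0 : ∀ k : d → ℤ, 0 ≤ 1 + freqNormSq k := fun k => by linarith [freqNormSq_nonneg k]
  refine Summable.of_nonneg_of_le (fun k => sq_nonneg _) (fun k => ?_) hsum
  by_cases hk : k = 0
  · subst hk
    rw [invLaplacianMultiplier, if_pos rfl, norm_zero, sq, mul_zero]
    exact mul_nonneg (by positivity) (Real.rpow_nonneg (hb0 0) _)
  · rw [norm_invLaplacianMultiplier_of_ne_zero hk]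
    have h1 : 1 ≤ freqNormSq k := one_le_freqNormSq_of_ne_zero hk
    have hpos : 0 < freqNormSq k := by linarith
    have hπ : 0 < 4 * Real.pi ^ 2 := by positivity
    -- `(1 + |k|²)^{-2} = ((1 + |k|²)²)⁻¹`
    have hr : (1 + freqNormSq k) ^ (-(2 : ℝ)) = ((1 + freqNormSq k) ^ 2)⁻¹ := by
      rw [Real.rpow_neg (hb0 k), Real.rpow_two]
    rw [hr]
    -- `(|k|²)⁻² ≤ 4 ((1+|k|²)²)⁻¹` since `|k|² ≥ 1`
    have h2 : ((freqNormSq k) ^ 2)⁻¹ ≤ 4 * ((1 + freqNormSq k) ^ 2)⁻¹ := by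
      rw [show (4 : ℝ) * ((1 + freqNormSq k) ^ 2)⁻¹ = ((1 + freqNormSq k) ^ 2 / 4)⁻¹ by
        rw [inv_div]; ring]
      refine inv_anti₀ (div_pos (pow_pos (by linarith) 2) (by norm_num)) ?_
      nlinarith
    calc ((4 * Real.pi ^ 2 * freqNormSq k)⁻¹) ^ 2
        = ((4 * Real.pi ^ 2) ^ 2)⁻¹ * ((freqNormSq k) ^ 2)⁻¹ := by ring
      _ ≤ ((4 * Real.pi ^ 2) ^ 2)⁻¹ * (4 * ((1 + freqNormSq k) ^ 2)⁻¹) :=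
          mul_le_mul_of_nonneg_left h2 (by positivity)
      _ = 4 * ((4 * Real.pi ^ 2)⁻¹) ^ 2 * ((1 + freqNormSq k) ^ 2)⁻¹ := by ring

end Lattice

/-! ## The sup-norm bound -/

section SupBound

variable [Nonempty d] [DecidableEq d]

/-- **Fourier inversion bound for `Δ⁻¹`**: `|Δ⁻¹h (x)| ≤ ∑_k |m(k)| |𝓕h(k)|` for smooth real `h`
(the Fourier series of the smooth function `Δ⁻¹h` converges absolutely to it, Grafakos 2014,
Prop. 3.2.5, and `𝓕(Δ⁻¹h) = m 𝓕h`). [folklore] -/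
theorem norm_invLaplacian_le_tsum {h : UnitAddTorus d → ℝ} (hh : IsSmooth h) (x : UnitAddTorus d) :
    ‖invLaplacian h x‖ ≤
      ∑' k : d → ℤ, ‖invLaplacianMultiplier k‖ * ‖mFourierCoeff (fun y => (h y : ℂ)) k‖ := by
  set w : UnitAddTorus d → ℂ := fun y => ((invLaplacian h y : ℝ) : ℂ) with hw_def
  have hw : IsSmooth w := (isSmooth_invLaplacian hh).ofReal
  have hc := hw.rapidDecay_mFourierCoeff
  have hsum : HasSum (fun k => mFourier k x • mFourierCoeff w k) (w x) := by
    have := hc.hasSum_fourierSynth x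
    rwa [hw.fourierSynth_mFourierCoeff] at this
  have hnorm : ∀ k, ‖mFourier k x • mFourierCoeff w k‖ =
      ‖invLaplacianMultiplier k‖ * ‖mFourierCoeff (fun y => (h y : ℂ)) k‖ := fun k => by
    rw [norm_mFourier_smul, hw_def, mFourierCoeff_ofReal_invLaplacian hh k, norm_mul]
  have hsn : Summable fun k => ‖mFourier k x • mFourierCoeff w k‖ := by
    simp_rw [norm_mFourier_smul]
    exact hc.summable_norm
  calc ‖invLaplacian h x‖ = ‖w x‖ := by rw [hw_def, Complex.norm_real]
    _ = ‖∑' k, mFourier k x • mFourierCoeff w k‖ := by rw [hsum.tsum_eq]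
    _ ≤ ∑' k, ‖mFourier k x • mFourierCoeff w k‖ := norm_tsum_le_tsum_norm hsn
    _ = _ := tsum_congr hnorm

/-- **`|Δ⁻¹h (x)| ≤ C_d ‖h‖_{L²}`** on `T^d`, `#d ≤ 3`, with `C_d = (∑_k |m(k)|²)^{1/2}`
(Cauchy–Schwarz in `ℓ²(ℤ^d)` and Parseval). [folklore] -/
theorem norm_invLaplacian_le_mul_sqrt_integral_sq (hd : Fintype.card d ≤ 3)
    {h : UnitAddTorus d → ℝ} (hh : IsSmooth h) (x : UnitAddTorus d) :
    ‖invLaplacian h x‖ ≤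
      (∑' k : d → ℤ, ‖invLaplacianMultiplier k‖ ^ 2) ^ (1 / 2 : ℝ) * (∫ y, h y ^ 2) ^ (1 / 2 : ℝ) := by
  have hP := hasSum_sq_mFourierCoeff_ofReal hh.continuous
  have hf2 : Summable fun k : d → ℤ => ‖invLaplacianMultiplier k‖ ^ (2 : ℝ) := by
    simp_rw [Real.rpow_two]
    exact summable_sq_norm_invLaplacianMultiplier hd
  have hg2 : Summable fun k : d → ℤ => ‖mFourierCoeff (fun y => (h y : ℂ)) k‖ ^ (2 : ℝ) := by
    simp_rw [Real.rpow_two]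
    exact hP.summable
  have hCS := Real.inner_le_Lp_mul_Lq_tsum_of_nonneg Real.HolderConjugate.two_two
    (f := fun k : d → ℤ => ‖invLaplacianMultiplier k‖)
    (g := fun k : d → ℤ => ‖mFourierCoeff (fun y => (h y : ℂ)) k‖)
    (fun k => norm_nonneg _) (fun k => norm_nonneg _) hf2 hg2
  simp only [Real.rpow_two] at hCS
  rw [hP.tsum_eq] at hCS
  exact (norm_invLaplacian_le_tsum hh x).trans hCS

/-- **`|Δ⁻¹h (x)| ≤ C_d M` whenever `|h| ≤ M`** on `T^d`, `#d ≤ 3` (`T^d` has measure one, so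
`‖h‖_{L²} ≤ M`). [folklore] -/
theorem norm_invLaplacian_le_of_forall_abs_le (hd : Fintype.card d ≤ 3)
    {h : UnitAddTorus d → ℝ} (hh : IsSmooth h) {M : ℝ} (hM : ∀ z, |h z| ≤ M) (x : UnitAddTorus d) :
    ‖invLaplacian h x‖ ≤ (∑' k : d → ℤ, ‖invLaplacianMultiplier k‖ ^ 2) ^ (1 / 2 : ℝ) * M := by
  have hM0 : 0 ≤ M := (abs_nonneg _).trans (hM x)
  refine (norm_invLaplacian_le_mul_sqrt_integral_sq hd hh x).trans
    (mul_le_mul_of_nonneg_left ?_ (Real.rpow_nonneg (tsum_nonneg fun k => sq_nonneg _) _))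
  have hint : ∫ y, h y ^ 2 ≤ M ^ 2 := by
    have hle : ∀ y, h y ^ 2 ≤ M ^ 2 := fun y => by
      rw [← sq_abs (h y)]
      exact pow_le_pow_left₀ (abs_nonneg _) (hM y) 2
    calc ∫ y, h y ^ 2 ≤ ∫ _y : UnitAddTorus d, M ^ 2 :=
          integral_mono (hh.continuous.pow 2).integrable_unitAddTorus (integrable_const _) hle
      _ = M ^ 2 := by simp
  calc (∫ y, h y ^ 2) ^ (1 / 2 : ℝ) ≤ (M ^ 2) ^ (1 / 2 : ℝ) :=
        Real.rpow_le_rpow (integral_nonneg fun y => sq_nonneg _) hint (by norm_num)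
    _ = M := by
        rw [← Real.sqrt_eq_rpow, Real.sqrt_sq hM0]

end SupBound

end Torus

end Literature.Analysis.FunctionSpaces
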